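import Literature.Algebra.Polynomial.FischerDecomposition
import Mathlib.Algebra.Algebra.Operations
import Mathlib.RingTheory.Adjoin.Basic
import HarnessLib

/-!
# Harmonics generate: `𝒫 = ℝ[S] · ℋ` (Goodman–Wallach, Theorem 5.1.4, surjectivity), the
# `O(n)` / `Sp(n)` / `k = 1` harmonic splittings, and Kashiwara–Vergne's `ℂ[X] = ℂ[xᵗy]·𝔥`

Goodman–Wallach, *Symmetry, Representations, and Invariants* (GTM 255), § 5.1.2, Theorem 5.1.4
(proof, first half) with Lemma 5.1.5, applied to the invariant quadrics of §§ 5.6.3–5.6.5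
[GoodmanWallachGTM255]. Continuation of `Literature.Algebra.Polynomial.FischerDecomposition`
(Lemma 5.1.5: `𝒫ᵏ = ℋᵏ ⊕ (𝒫S)ᵏ`); notation as there (`D = (f ↦ ∂(f))`, `ℋ = ⨅ g ∈ S, ker ∂(g)`),
real coefficients throughout.

* § 1 **Theorem 5.1.4, surjectivity half, for any set `S` of homogeneous polynomials of positive
  degree**: `one_mem_harmonic` (`1 ∈ ℋ`), `adjoin_mul_harmonic_eq_top` (`ℝ[S] · ℋ = 𝒫` as
  `ℝ`-submodules: `Subalgebra.toSubmodule (Algebra.adjoin ℝ S) * ℋ = ⊤`),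
  `exists_sum_adjoin_mul_harmonic` (every `f` is `∑ uⱼ hⱼ`, `uⱼ ∈ ℝ[S]`, `hⱼ ∈ ℋ`). The proof is
  the printed induction on the degree ("since `1 ∈ ℋ` … by Lemma 5.1.5 we may write
  `f = h + ∑ fᵢ gᵢ` … the degree of `fᵢ` is less than the degree of `f`"). The injectivity half of
  Theorem 5.1.4 (freeness over `𝒥`) is special to `S = 𝒥₊(𝔖ₙ)` and is not formalised.
* § 2 `S = {M_ij = (x_i, x_j)}` on `𝒫(M_{n,k}) = MvPolynomial (τ × ι) ℝ` (§ 5.6.3; `∂(M_ij) = Δ_ij`):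
  `homogeneousSubmodule_eq_laplacian_harmonic_sup_span`, `disjoint_laplacian_harmonic_span`
  (`𝒫ᵏ = (𝒫ᵏ ∩ ⋂ ker Δ_ij) ⊕ (𝒫ᵏ ∩ 𝒫·{M_ij})`) and `adjoin_M_mul_laplacian_harmonic_eq_top`
  (`𝒫 = ℝ[M_ij] · ⋂ ker Δ_ij`) — the `O(n)`-harmonics ("pluriharmonic polynomials") generate `𝒫`
  over the invariant quadrics.
* § 3 `S = {S_ij = ω(x_i, x_j)}` on `𝒫(M_{2n,k}) = MvPolynomial ((τ ⊕ τ) × ι) ℝ` (§ 5.6.5;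
  `∂(S_ij) = D_ij`): `homogeneousSubmodule_eq_D_harmonic_sup_span`, `disjoint_D_harmonic_span`,
  `adjoin_S_mul_D_harmonic_eq_top`.
* § 4 `k = 1`, `S = {r²}` (§ 5.6.4; `∂(r²) = Δ`): `homogeneousSubmodule_eq_ker_laplacian_sup_span`,
  `adjoin_rsq_mul_ker_laplacian_eq_top` (`𝒫 = ℝ[r²] · ker Δ`, the surjectivity in Corollary 5.6.12
  over `ℝ`; the characteristic-`0` graded version is `ClassicalInvariants.SphericalHarmonics`).
* § 5 the Kashiwara–Vergne system (Invent. Math. 44 (1978), Ch. III (5.1)): `Δ_ij = ∑_ν ∂²/∂x_{iν}∂y_{jν}`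
  on `𝒫(M(p,k) × M(q,k)) = MvPolynomial ((ιx ⊕ ιy) × κ) ℝ`, `S = {(xᵗy)_{ij} = ∑_ν x_{iν} y_{jν}}`:
  `homogeneousSubmodule_eq_pluriharmonic_sup_span`, `disjoint_pluriharmonic_span`, and
  **KV Lemma (5.3) `ℂ[X] = ℂ[xᵗy]·𝔥`** over `ℝ` for every `k`: `adjoin_xty_mul_pluriharmonic_eq_top`
  (the tree's `KashiwaraVergne1978.PluriharmonicPolynomials` has `k = 1` over any field)
  [KashiwaraVergne1978].

The operators enter as hypotheses exactly as in `ClassicalInvariants.OnSpDualityOperators` /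
`SpSoDualityOperators` / `SphericalHarmonics` (`hΔ`, `hM`; `hDop`, `hS`; `hΔ`, `hr2`); the
homomorphism `f ↦ ∂(f)` is obtained inside the proofs from
`FischerDecomposition.exists_algHom_pderiv`, so the statements of §§ 2–4 do not mention it.

References: R. Goodman, N. R. Wallach, GTM 255, Springer 2009, § 5.1.2 Theorem 5.1.4, Lemma 5.1.5;
§ 5.6.3, § 5.6.4 Corollary 5.6.12, § 5.6.5 [GoodmanWallachGTM255]; M. Kashiwara, M. Vergne, Invent.
Math. 44 (1978) 1–47, Ch. III (5.1)–(5.3), pp. 41–42 [KashiwaraVergne1978].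
-/

open MvPolynomial
open scoped BigOperators

namespace Literature.RepresentationTheory.ClassicalInvariants.HarmonicGeneration

open Literature.Algebra.Polynomial Literature.Algebra.Polynomial.FischerDecomposition

noncomputable section

universe v w

/-! ## § 1. Theorem 5.1.4 (surjectivity half): `𝒫 = ℝ[S] · ℋ` for homogeneous `S` of positive degree -/

section General

variable {ι : Type*} [Fintype ι] [DecidableEq ι]

omit [DecidableEq ι] in
/-- `⟨q | 1⟩ = q(0)`: the Fischer pairing with `1` is the constant coefficient. [folklore] -/
private theorem fischerInner_one_right [DecidableEq ι] (q : MvPolynomial ι ℝ) :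
    fischerInner q 1 = coeff 0 q := by
  rw [fischerInner_eq_sum_of_subset (s := q.support ∪ {0}) (by
    intro α hα
    rw [Finset.mem_union] at hα ⊢
    rcases hα with h | h
    · exact Or.inl h
    · right
      rw [Finset.mem_singleton]
      by_contra h0
      rw [mem_support_iff, show (1 : MvPolynomial ι ℝ) = C 1 from rfl, coeff_C, if_neg (Ne.symm h0)]
        at h
      exact h rfl)]
  rw [Finset.sum_eq_single (0 : ι →₀ ℕ)]
  · rw [show (1 : MvPolynomial ι ℝ) = C 1 from rfl, coeff_C, if_pos rfl, mul_one]
    unfold mfactorial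
    simp
  · intro α _ hα
    rw [show (1 : MvPolynomial ι ℝ) = C 1 from rfl, coeff_C, if_neg (Ne.symm hα), mul_zero, mul_zero]
  · intro h
    exact absurd (Finset.mem_union_right _ (Finset.mem_singleton_self _)) h

/-- `1` is `S`-harmonic when `S` consists of homogeneous polynomials of positive degree
("since `1 ∈ ℋ`"). [cite: GoodmanWallachGTM255, Theorem 5.1.4 (proof)] -/
theorem one_mem_harmonic (D : MvPolynomial ι ℝ →ₐ[ℝ] Module.End ℝ (MvPolynomial ι ℝ))
    (hD : ∀ i, D (X i) =
      ((pderiv i : Derivation ℝ (MvPolynomial ι ℝ) (MvPolynomial ι ℝ)) :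
        Module.End ℝ (MvPolynomial ι ℝ)))
    {S : Set (MvPolynomial ι ℝ)} (hS : ∀ g ∈ S, ∃ d, 0 < d ∧ g.IsHomogeneous d) :
    (1 : MvPolynomial ι ℝ) ∈ ⨅ g ∈ S, LinearMap.ker (D g) := by
  have h1 : ∀ g ∈ S, D g 1 = 0 := by
    rw [forall_apply_eq_zero_iff_forall_mem_span D hD]
    intro q hq
    rw [fischerInner_one_right]
    -- `q ∈ 𝒫S` has zero constant coefficient
    have hle : Ideal.span S ≤ RingHom.ker (constantCoeff : MvPolynomial ι ℝ →+* ℝ) := by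
      rw [Ideal.span_le]
      intro g hg
      obtain ⟨d, hd, hgd⟩ := hS g hg
      rw [SetLike.mem_coe, RingHom.mem_ker, constantCoeff_eq]
      exact hgd.coeff_eq_zero (by rw [map_zero]; exact Nat.ne_of_lt hd)
    have := hle hq
    rwa [RingHom.mem_ker, constantCoeff_eq] at this
  simp only [Submodule.mem_iInf, LinearMap.mem_ker]
  exact h1

/-- **Theorem 5.1.4, surjectivity of `ℝ[S] ⊗ ℋ → 𝒫`.** If `S` consists of homogeneous polynomials
of positive degree, then `𝒫 = ℝ[S] · ℋ`: the products `u h` (`u` in the subalgebra generated by `S`,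
`h` `S`-harmonic) span `𝒫`. Proof as printed: by induction on the degree, using Lemma 5.1.5
(`FischerDecomposition.exists_harmonic_add_mem_span`) and that the elements of `S` have no constant
term. (The book states this for `S = 𝒥₊`; the injectivity half of Theorem 5.1.4 is special to
that case and is not formalised.) [cite: GoodmanWallachGTM255, Theorem 5.1.4 (proof, first half)] -/
theorem adjoin_mul_harmonic_eq_top (D : MvPolynomial ι ℝ →ₐ[ℝ] Module.End ℝ (MvPolynomial ι ℝ))
    (hD : ∀ i, D (X i) =
      ((pderiv i : Derivation ℝ (MvPolynomial ι ℝ) (MvPolynomial ι ℝ)) :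
        Module.End ℝ (MvPolynomial ι ℝ)))
    {S : Set (MvPolynomial ι ℝ)} (hS : ∀ g ∈ S, ∃ d, 0 < d ∧ g.IsHomogeneous d) :
    Subalgebra.toSubmodule (Algebra.adjoin ℝ S) * (⨅ g ∈ S, LinearMap.ker (D g)) = ⊤ := by
  set H : Submodule ℝ (MvPolynomial ι ℝ) := ⨅ g ∈ S, LinearMap.ker (D g) with hH
  set N := Subalgebra.toSubmodule (Algebra.adjoin ℝ S) * H with hN
  have hS' : ∀ g ∈ S, ∃ d, g.IsHomogeneous d := fun g hg => by
    obtain ⟨d, -, hd⟩ := hS g hg; exact ⟨d, hd⟩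
  -- `N` is stable under multiplication by `ℝ[S]`
  have hNmul : ∀ s ∈ Algebra.adjoin ℝ S, ∀ n ∈ N, s * n ∈ N := by
    intro s hs n hn
    refine Submodule.mul_induction_on hn (fun a ha h hh => ?_) (fun x y hx hy => ?_)
    · rw [← mul_assoc]
      exact Submodule.mul_mem_mul (Subalgebra.mul_mem _ hs ha) hh
    · rw [mul_add]; exact N.add_mem hx hy
  -- every homogeneous polynomial lies in `N`, by strong induction on the degree
  have key : ∀ k (f : MvPolynomial ι ℝ), f.IsHomogeneous k → f ∈ N := by
    intro k
    induction k using Nat.strong_induction_on with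
    | _ k ih =>
      intro f hf
      obtain ⟨h, q, -, hh, hq, hqS, rfl⟩ := exists_harmonic_add_mem_span D hD hS' hf
      refine N.add_mem ?_ ?_
      · have hhH : h ∈ H := by
          simp only [hH, Submodule.mem_iInf, LinearMap.mem_ker]; exact hh
        simpa using Submodule.mul_mem_mul
          (show (1 : MvPolynomial ι ℝ) ∈ Subalgebra.toSubmodule (Algebra.adjoin ℝ S) from
            Subalgebra.one_mem _) hhH
      · -- `q = ∑ cᵢ gᵢ`, `gᵢ ∈ S`; compare degree-`k` components
        obtain ⟨n, c, g, hsum⟩ := Submodule.mem_span_set'.mp hqS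
        have hqk : q = homogeneousComponent k q := by
          rw [homogeneousComponent_of_mem ((mem_homogeneousSubmodule k q).mpr hq), if_pos rfl]
        rw [hqk, ← hsum, map_sum]
        refine N.sum_mem fun i _ => ?_
        obtain ⟨d, hd0, hgd⟩ := hS (g i) (g i).2
        letI := MvPolynomial.gradedAlgebra (σ := ι) (R := ℝ)
        have hgmem : ((g i : MvPolynomial ι ℝ)) ∈ homogeneousSubmodule ι ℝ d :=
          (mem_homogeneousSubmodule d _).mpr hgd
        rw [smul_eq_mul]
        by_cases hdk : d ≤ k
        · have e : homogeneousComponent k (c i * (g i : MvPolynomial ι ℝ)) =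
              homogeneousComponent (k - d) (c i) * (g i : MvPolynomial ι ℝ) := by
            have := DirectSum.coe_decompose_mul_of_right_mem_of_le
              (𝒜 := homogeneousSubmodule ι ℝ) (a := c i) hgmem hdk
            rwa [show ((DirectSum.decompose (homogeneousSubmodule ι ℝ) (c i * ↑(g i)) k :
                MvPolynomial ι ℝ)) = homogeneousComponent k (c i * ↑(g i)) from
                decomposition.decompose'_apply _ _,
              show ((DirectSum.decompose (homogeneousSubmodule ι ℝ) (c i) (k - d) :
                MvPolynomial ι ℝ)) = homogeneousComponent (k - d) (c i) from
                decomposition.decompose'_apply _ _] at this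
          rw [e, mul_comm]
          refine hNmul _ (Algebra.subset_adjoin (g i).2) _ ?_
          exact ih (k - d) (by omega) _ (homogeneousComponent_isHomogeneous _ _)
        · have e : homogeneousComponent k (c i * (g i : MvPolynomial ι ℝ)) = 0 := by
            have := DirectSum.coe_decompose_mul_of_right_mem_of_not_le
              (𝒜 := homogeneousSubmodule ι ℝ) (a := c i) hgmem hdk
            rwa [show ((DirectSum.decompose (homogeneousSubmodule ι ℝ) (c i * ↑(g i)) k :
                MvPolynomial ι ℝ)) = homogeneousComponent k (c i * ↑(g i)) from
                decomposition.decompose'_apply _ _] at this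
          rw [e]; exact N.zero_mem
  refine eq_top_iff.mpr fun f _ => ?_
  rw [← sum_homogeneousComponent f]
  exact N.sum_mem fun i _ => key i _ (homogeneousComponent_isHomogeneous i f)

/-- **Theorem 5.1.4 (surjectivity), elementwise**: every polynomial is a finite sum `∑ uⱼ hⱼ`
with `uⱼ ∈ ℝ[S]` and `hⱼ` `S`-harmonic. [cite: GoodmanWallachGTM255, Theorem 5.1.4 (proof, first half)] -/
theorem exists_sum_adjoin_mul_harmonic (D : MvPolynomial ι ℝ →ₐ[ℝ] Module.End ℝ (MvPolynomial ι ℝ))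
    (hD : ∀ i, D (X i) =
      ((pderiv i : Derivation ℝ (MvPolynomial ι ℝ) (MvPolynomial ι ℝ)) :
        Module.End ℝ (MvPolynomial ι ℝ)))
    {S : Set (MvPolynomial ι ℝ)} (hS : ∀ g ∈ S, ∃ d, 0 < d ∧ g.IsHomogeneous d)
    (f : MvPolynomial ι ℝ) :
    ∃ (n : ℕ) (u h : Fin n → MvPolynomial ι ℝ), (∀ j, u j ∈ Algebra.adjoin ℝ S) ∧
      (∀ j, ∀ g ∈ S, D g (h j) = 0) ∧ f = ∑ j, u j * h j := by
  have hf : f ∈ Subalgebra.toSubmodule (Algebra.adjoin ℝ S) * (⨅ g ∈ S, LinearMap.ker (D g)) := by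
    rw [adjoin_mul_harmonic_eq_top D hD hS]; exact Submodule.mem_top
  rw [Submodule.mul_eq_span_mul_set] at hf
  obtain ⟨n, c, g, hsum⟩ := Submodule.mem_span_set'.mp hf
  have hg : ∀ j, ∃ u h, u ∈ Algebra.adjoin ℝ S ∧ (∀ s ∈ S, D s h = 0) ∧
      (g j : MvPolynomial ι ℝ) = u * h := by
    intro j
    obtain ⟨u, hu, h, hh, e⟩ := Set.mem_mul.mp (g j).2
    refine ⟨u, h, hu, fun s hs => ?_, e.symm⟩
    have := (Submodule.mem_iInf _).mp hh s
    rw [Submodule.mem_iInf] at this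
    exact this hs
  choose u h hu hh he using hg
  refine ⟨n, fun j => c j • u j, h, fun j => Subalgebra.smul_mem _ (hu j) _, hh, ?_⟩
  rw [← hsum]
  exact Finset.sum_congr rfl fun j _ => by rw [he j, smul_mul_assoc]

end General

/-! ## § 2. The `O(n)`-harmonics on `𝒫(M_{n,k})`: `S = {(x_i, x_j)}`, `ℋ = ⋂ ker Δ_ij` -/

section Orthogonal

variable {τ : Type v} {ι : Type w} [Fintype τ] [Fintype ι] [DecidableEq τ] [DecidableEq ι]

omit [Fintype ι] [DecidableEq τ] [DecidableEq ι] in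
/-- For the homomorphism `f ↦ ∂(f)`: `∂(M_ij) = Δ_ij`. [folklore] -/
private theorem D_M (D : MvPolynomial (τ × ι) ℝ →ₐ[ℝ] Module.End ℝ (MvPolynomial (τ × ι) ℝ))
    (hD : ∀ x, D (X x) =
      ((pderiv x : Derivation ℝ (MvPolynomial (τ × ι) ℝ) (MvPolynomial (τ × ι) ℝ)) :
        Module.End ℝ (MvPolynomial (τ × ι) ℝ)))
    (Δ : ι → ι → MvPolynomial (τ × ι) ℝ →ₗ[ℝ] MvPolynomial (τ × ι) ℝ)
    (hΔ : ∀ i j f, Δ i j f = ∑ p : τ, pderiv (p, i) (pderiv (p, j) f))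
    (M : ι → ι → MvPolynomial (τ × ι) ℝ) (hM : ∀ i j, M i j = ∑ p : τ, X (p, i) * X (p, j))
    (i j : ι) : D (M i j) = Δ i j := by
  refine LinearMap.ext fun f => ?_
  rw [hM, map_sum, hΔ, LinearMap.coe_sum, Finset.sum_apply]
  refine Finset.sum_congr rfl fun p _ => ?_
  rw [map_mul, Module.End.mul_apply, hD, hD]
  rfl

omit [Fintype ι] [DecidableEq τ] [DecidableEq ι] in
/-- The `O(n)`-harmonics `⋂_{ij} ker Δ_ij` are the `S`-harmonics for `S = {M_ij}`. [folklore] -/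
private theorem harmonic_eq_O (D : MvPolynomial (τ × ι) ℝ →ₐ[ℝ] Module.End ℝ (MvPolynomial (τ × ι) ℝ))
    (hD : ∀ x, D (X x) =
      ((pderiv x : Derivation ℝ (MvPolynomial (τ × ι) ℝ) (MvPolynomial (τ × ι) ℝ)) :
        Module.End ℝ (MvPolynomial (τ × ι) ℝ)))
    (Δ : ι → ι → MvPolynomial (τ × ι) ℝ →ₗ[ℝ] MvPolynomial (τ × ι) ℝ)
    (hΔ : ∀ i j f, Δ i j f = ∑ p : τ, pderiv (p, i) (pderiv (p, j) f))
    (M : ι → ι → MvPolynomial (τ × ι) ℝ) (hM : ∀ i j, M i j = ∑ p : τ, X (p, i) * X (p, j)) :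
    (⨅ g ∈ Set.range (fun p : ι × ι => M p.1 p.2), LinearMap.ker (D g)) =
      ⨅ p : ι × ι, LinearMap.ker (Δ p.1 p.2) := by
  ext f
  simp only [Submodule.mem_iInf, LinearMap.mem_ker, Set.mem_range]
  constructor
  · intro h p
    rw [← D_M D hD Δ hΔ M hM]
    exact h _ ⟨p, rfl⟩
  · rintro h _ ⟨p, rfl⟩
    rw [D_M D hD Δ hΔ M hM]
    exact h p

omit [Fintype ι] [DecidableEq τ] [DecidableEq ι] in
/-- The quadrics `M_ij` are homogeneous of degree `2`. [folklore] -/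
private theorem M_isHomogeneous (M : ι → ι → MvPolynomial (τ × ι) ℝ)
    (hM : ∀ i j, M i j = ∑ p : τ, X (p, i) * X (p, j)) (i j : ι) : (M i j).IsHomogeneous 2 := by
  rw [hM]
  exact IsHomogeneous.sum _ _ _ fun p _ => (isHomogeneous_X ℝ (p, i)).mul (isHomogeneous_X ℝ (p, j))

/-- **The `O(n)`-harmonic splitting** (Lemma 5.1.5 for `S = {(x_i, x_j)}`, the `O(n)`-invariant
quadrics of § 5.6.3, whose `∂`-images are the Laplacians `Δ_ij`): for every degree `k`,
`𝒫ᵏ(M_{n,k}) = (𝒫ᵏ ∩ ⋂_{ij} ker Δ_ij) ⊕ (𝒫ᵏ ∩ 𝒫·{(x_i,x_j)})`, over `ℝ`.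
[cite: GoodmanWallachGTM255, Lemma 5.1.5 applied to the operators M_ij, Δ_ij of §5.6.3] -/
theorem homogeneousSubmodule_eq_laplacian_harmonic_sup_span
    (Δ : ι → ι → MvPolynomial (τ × ι) ℝ →ₗ[ℝ] MvPolynomial (τ × ι) ℝ)
    (hΔ : ∀ i j f, Δ i j f = ∑ p : τ, pderiv (p, i) (pderiv (p, j) f))
    (M : ι → ι → MvPolynomial (τ × ι) ℝ) (hM : ∀ i j, M i j = ∑ p : τ, X (p, i) * X (p, j))
    (k : ℕ) :
    homogeneousSubmodule (τ × ι) ℝ k =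
      (homogeneousSubmodule (τ × ι) ℝ k ⊓ ⨅ p : ι × ι, LinearMap.ker (Δ p.1 p.2)) ⊔
        (homogeneousSubmodule (τ × ι) ℝ k ⊓
          (Ideal.span (Set.range fun p : ι × ι => M p.1 p.2)).restrictScalars ℝ) := by
  obtain ⟨D, hD⟩ := exists_algHom_pderiv (ι := τ × ι)
  rw [← harmonic_eq_O D hD Δ hΔ M hM]
  refine homogeneousSubmodule_eq_harmonic_sup_span D hD (fun g hg => ?_) k
  obtain ⟨p, rfl⟩ := hg
  exact ⟨2, M_isHomogeneous M hM p.1 p.2⟩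

/-- … and the sum is direct. [cite: GoodmanWallachGTM255, Lemma 5.1.5 applied to M_ij, Δ_ij of §5.6.3] -/
theorem disjoint_laplacian_harmonic_span
    (Δ : ι → ι → MvPolynomial (τ × ι) ℝ →ₗ[ℝ] MvPolynomial (τ × ι) ℝ)
    (hΔ : ∀ i j f, Δ i j f = ∑ p : τ, pderiv (p, i) (pderiv (p, j) f))
    (M : ι → ι → MvPolynomial (τ × ι) ℝ) (hM : ∀ i j, M i j = ∑ p : τ, X (p, i) * X (p, j)) :
    Disjoint (⨅ p : ι × ι, LinearMap.ker (Δ p.1 p.2))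
      ((Ideal.span (Set.range fun p : ι × ι => M p.1 p.2)).restrictScalars ℝ) := by
  obtain ⟨D, hD⟩ := exists_algHom_pderiv (ι := τ × ι)
  rw [← harmonic_eq_O D hD Δ hΔ M hM]
  exact disjoint_harmonic_span D hD _

/-- **The `O(n)`-harmonics generate `𝒫(M_{n,k})` over the invariant quadrics**:
`𝒫 = ℝ[(x_i, x_j)] · ℋ`, `ℋ = ⋂_{ij} ker Δ_ij` (Theorem 5.1.4, surjectivity half, for
`S = {(x_i, x_j)}`). [cite: GoodmanWallachGTM255, Theorem 5.1.4 (proof, first half) applied to M_ij, Δ_ij of §5.6.3] -/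
theorem adjoin_M_mul_laplacian_harmonic_eq_top
    (Δ : ι → ι → MvPolynomial (τ × ι) ℝ →ₗ[ℝ] MvPolynomial (τ × ι) ℝ)
    (hΔ : ∀ i j f, Δ i j f = ∑ p : τ, pderiv (p, i) (pderiv (p, j) f))
    (M : ι → ι → MvPolynomial (τ × ι) ℝ) (hM : ∀ i j, M i j = ∑ p : τ, X (p, i) * X (p, j)) :
    Subalgebra.toSubmodule (Algebra.adjoin ℝ (Set.range fun p : ι × ι => M p.1 p.2)) *
        (⨅ p : ι × ι, LinearMap.ker (Δ p.1 p.2)) = ⊤ := by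
  obtain ⟨D, hD⟩ := exists_algHom_pderiv (ι := τ × ι)
  rw [← harmonic_eq_O D hD Δ hΔ M hM]
  refine adjoin_mul_harmonic_eq_top D hD fun g hg => ?_
  obtain ⟨p, rfl⟩ := hg
  exact ⟨2, two_pos, M_isHomogeneous M hM p.1 p.2⟩

end Orthogonal

/-! ## § 3. The `Sp(n)`-harmonics on `𝒫(M_{2n,k})`: `S = {ω(x_i, x_j)}`, `ℋ = ⋂ ker D_ij` -/

section Symplectic

variable {τ : Type v} {ι : Type w} [Fintype τ] [Fintype ι] [DecidableEq τ] [DecidableEq ι]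

omit [Fintype ι] [DecidableEq τ] [DecidableEq ι] in
/-- `∂(S_ij) = D_ij`. [folklore] -/
private theorem D_S
    (D : MvPolynomial ((τ ⊕ τ) × ι) ℝ →ₐ[ℝ] Module.End ℝ (MvPolynomial ((τ ⊕ τ) × ι) ℝ))
    (hD : ∀ x, D (X x) =
      ((pderiv x : Derivation ℝ (MvPolynomial ((τ ⊕ τ) × ι) ℝ) (MvPolynomial ((τ ⊕ τ) × ι) ℝ)) :
        Module.End ℝ (MvPolynomial ((τ ⊕ τ) × ι) ℝ)))
    (Dop : ι → ι → MvPolynomial ((τ ⊕ τ) × ι) ℝ →ₗ[ℝ] MvPolynomial ((τ ⊕ τ) × ι) ℝ)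
    (hDop : ∀ i j f, Dop i j f = ∑ p : τ, (pderiv (Sum.inl p, i) (pderiv (Sum.inr p, j) f) -
      pderiv (Sum.inr p, i) (pderiv (Sum.inl p, j) f)))
    (S : ι → ι → MvPolynomial ((τ ⊕ τ) × ι) ℝ)
    (hS : ∀ i j, S i j = ∑ p : τ, (X (Sum.inl p, i) * X (Sum.inr p, j) -
      X (Sum.inr p, i) * X (Sum.inl p, j))) (i j : ι) : D (S i j) = Dop i j := by
  refine LinearMap.ext fun f => ?_
  rw [hS, map_sum, hDop, LinearMap.coe_sum, Finset.sum_apply]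
  refine Finset.sum_congr rfl fun p _ => ?_
  rw [map_sub, LinearMap.sub_apply, map_mul, map_mul, Module.End.mul_apply, Module.End.mul_apply,
    hD, hD, hD, hD]
  rfl

omit [Fintype ι] [DecidableEq τ] [DecidableEq ι] in
/-- The `Sp(n)`-harmonics `⋂_{ij} ker D_ij` are the `S`-harmonics for `S = {S_ij}`. [folklore] -/
private theorem harmonic_eq_Sp
    (D : MvPolynomial ((τ ⊕ τ) × ι) ℝ →ₐ[ℝ] Module.End ℝ (MvPolynomial ((τ ⊕ τ) × ι) ℝ))
    (hD : ∀ x, D (X x) =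
      ((pderiv x : Derivation ℝ (MvPolynomial ((τ ⊕ τ) × ι) ℝ) (MvPolynomial ((τ ⊕ τ) × ι) ℝ)) :
        Module.End ℝ (MvPolynomial ((τ ⊕ τ) × ι) ℝ)))
    (Dop : ι → ι → MvPolynomial ((τ ⊕ τ) × ι) ℝ →ₗ[ℝ] MvPolynomial ((τ ⊕ τ) × ι) ℝ)
    (hDop : ∀ i j f, Dop i j f = ∑ p : τ, (pderiv (Sum.inl p, i) (pderiv (Sum.inr p, j) f) -
      pderiv (Sum.inr p, i) (pderiv (Sum.inl p, j) f)))
    (S : ι → ι → MvPolynomial ((τ ⊕ τ) × ι) ℝ)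
    (hS : ∀ i j, S i j = ∑ p : τ, (X (Sum.inl p, i) * X (Sum.inr p, j) -
      X (Sum.inr p, i) * X (Sum.inl p, j))) :
    (⨅ g ∈ Set.range (fun p : ι × ι => S p.1 p.2), LinearMap.ker (D g)) =
      ⨅ p : ι × ι, LinearMap.ker (Dop p.1 p.2) := by
  ext f
  simp only [Submodule.mem_iInf, LinearMap.mem_ker, Set.mem_range]
  constructor
  · intro h p
    rw [← D_S D hD Dop hDop S hS]
    exact h _ ⟨p, rfl⟩
  · rintro h _ ⟨p, rfl⟩
    rw [D_S D hD Dop hDop S hS]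
    exact h p

omit [Fintype ι] [DecidableEq τ] [DecidableEq ι] in
/-- The symplectic quadrics `S_ij` are homogeneous of degree `2`. [folklore] -/
private theorem S_isHomogeneous (S : ι → ι → MvPolynomial ((τ ⊕ τ) × ι) ℝ)
    (hS : ∀ i j, S i j = ∑ p : τ, (X (Sum.inl p, i) * X (Sum.inr p, j) -
      X (Sum.inr p, i) * X (Sum.inl p, j))) (i j : ι) : (S i j).IsHomogeneous 2 := by
  rw [hS]
  exact IsHomogeneous.sum _ _ _ fun p _ =>
    ((isHomogeneous_X ℝ _).mul (isHomogeneous_X ℝ _)).sub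
      ((isHomogeneous_X ℝ _).mul (isHomogeneous_X ℝ _))

/-- **The `Sp(n)`-harmonic splitting** (Lemma 5.1.5 for `S = {ω(x_i, x_j)}`, the
`Sp(n)`-invariant quadrics of § 5.6.5, whose `∂`-images are the operators `D_ij`):
`𝒫ᵏ(M_{2n,k}) = (𝒫ᵏ ∩ ⋂_{ij} ker D_ij) ⊕ (𝒫ᵏ ∩ 𝒫·{ω(x_i,x_j)})`, over `ℝ`.
[cite: GoodmanWallachGTM255, Lemma 5.1.5 applied to the operators S_ij, D_ij of §5.6.5] -/
theorem homogeneousSubmodule_eq_D_harmonic_sup_span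
    (Dop : ι → ι → MvPolynomial ((τ ⊕ τ) × ι) ℝ →ₗ[ℝ] MvPolynomial ((τ ⊕ τ) × ι) ℝ)
    (hDop : ∀ i j f, Dop i j f = ∑ p : τ, (pderiv (Sum.inl p, i) (pderiv (Sum.inr p, j) f) -
      pderiv (Sum.inr p, i) (pderiv (Sum.inl p, j) f)))
    (S : ι → ι → MvPolynomial ((τ ⊕ τ) × ι) ℝ)
    (hS : ∀ i j, S i j = ∑ p : τ, (X (Sum.inl p, i) * X (Sum.inr p, j) -
      X (Sum.inr p, i) * X (Sum.inl p, j))) (k : ℕ) :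
    homogeneousSubmodule ((τ ⊕ τ) × ι) ℝ k =
      (homogeneousSubmodule ((τ ⊕ τ) × ι) ℝ k ⊓ ⨅ p : ι × ι, LinearMap.ker (Dop p.1 p.2)) ⊔
        (homogeneousSubmodule ((τ ⊕ τ) × ι) ℝ k ⊓
          (Ideal.span (Set.range fun p : ι × ι => S p.1 p.2)).restrictScalars ℝ) := by
  obtain ⟨D, hD⟩ := exists_algHom_pderiv (ι := (τ ⊕ τ) × ι)
  rw [← harmonic_eq_Sp D hD Dop hDop S hS]
  refine homogeneousSubmodule_eq_harmonic_sup_span D hD (fun g hg => ?_) k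
  obtain ⟨p, rfl⟩ := hg
  exact ⟨2, S_isHomogeneous S hS p.1 p.2⟩

/-- … and the sum is direct. [cite: GoodmanWallachGTM255, Lemma 5.1.5 applied to S_ij, D_ij of §5.6.5] -/
theorem disjoint_D_harmonic_span
    (Dop : ι → ι → MvPolynomial ((τ ⊕ τ) × ι) ℝ →ₗ[ℝ] MvPolynomial ((τ ⊕ τ) × ι) ℝ)
    (hDop : ∀ i j f, Dop i j f = ∑ p : τ, (pderiv (Sum.inl p, i) (pderiv (Sum.inr p, j) f) -
      pderiv (Sum.inr p, i) (pderiv (Sum.inl p, j) f)))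
    (S : ι → ι → MvPolynomial ((τ ⊕ τ) × ι) ℝ)
    (hS : ∀ i j, S i j = ∑ p : τ, (X (Sum.inl p, i) * X (Sum.inr p, j) -
      X (Sum.inr p, i) * X (Sum.inl p, j))) :
    Disjoint (⨅ p : ι × ι, LinearMap.ker (Dop p.1 p.2))
      ((Ideal.span (Set.range fun p : ι × ι => S p.1 p.2)).restrictScalars ℝ) := by
  obtain ⟨D, hD⟩ := exists_algHom_pderiv (ι := (τ ⊕ τ) × ι)
  rw [← harmonic_eq_Sp D hD Dop hDop S hS]
  exact disjoint_harmonic_span D hD _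

/-- **The `Sp(n)`-harmonics generate `𝒫(M_{2n,k})` over the invariant quadrics**:
`𝒫 = ℝ[ω(x_i, x_j)] · ℋ`, `ℋ = ⋂_{ij} ker D_ij`.
[cite: GoodmanWallachGTM255, Theorem 5.1.4 (proof, first half) applied to S_ij, D_ij of §5.6.5] -/
theorem adjoin_S_mul_D_harmonic_eq_top
    (Dop : ι → ι → MvPolynomial ((τ ⊕ τ) × ι) ℝ →ₗ[ℝ] MvPolynomial ((τ ⊕ τ) × ι) ℝ)
    (hDop : ∀ i j f, Dop i j f = ∑ p : τ, (pderiv (Sum.inl p, i) (pderiv (Sum.inr p, j) f) -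
      pderiv (Sum.inr p, i) (pderiv (Sum.inl p, j) f)))
    (S : ι → ι → MvPolynomial ((τ ⊕ τ) × ι) ℝ)
    (hS : ∀ i j, S i j = ∑ p : τ, (X (Sum.inl p, i) * X (Sum.inr p, j) -
      X (Sum.inr p, i) * X (Sum.inl p, j))) :
    Subalgebra.toSubmodule (Algebra.adjoin ℝ (Set.range fun p : ι × ι => S p.1 p.2)) *
        (⨅ p : ι × ι, LinearMap.ker (Dop p.1 p.2)) = ⊤ := by
  obtain ⟨D, hD⟩ := exists_algHom_pderiv (ι := (τ ⊕ τ) × ι)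
  rw [← harmonic_eq_Sp D hD Dop hDop S hS]
  refine adjoin_mul_harmonic_eq_top D hD fun g hg => ?_
  obtain ⟨p, rfl⟩ := hg
  exact ⟨2, two_pos, S_isHomogeneous S hS p.1 p.2⟩

end Symplectic

/-! ## § 4. The classical case `k = 1`: `S = {r²}`, `ℋ = ker Δ` -/

section Spherical

variable {σ : Type v} [Fintype σ] [DecidableEq σ]

omit [DecidableEq σ] in
/-- `∂(r²) = Δ`. [folklore] -/
private theorem D_rsq (D : MvPolynomial σ ℝ →ₐ[ℝ] Module.End ℝ (MvPolynomial σ ℝ))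
    (hD : ∀ i, D (X i) =
      ((pderiv i : Derivation ℝ (MvPolynomial σ ℝ) (MvPolynomial σ ℝ)) :
        Module.End ℝ (MvPolynomial σ ℝ)))
    (Δ : MvPolynomial σ ℝ →ₗ[ℝ] MvPolynomial σ ℝ) (hΔ : ∀ f, Δ f = ∑ i, pderiv i (pderiv i f))
    (r2 : MvPolynomial σ ℝ) (hr2 : r2 = ∑ i, X i ^ 2) : D r2 = Δ := by
  refine LinearMap.ext fun f => ?_
  rw [hr2, map_sum, hΔ, LinearMap.coe_sum, Finset.sum_apply]
  refine Finset.sum_congr rfl fun i _ => ?_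
  rw [map_pow, pow_two, Module.End.mul_apply, hD]
  rfl

/-- **The harmonic splitting for `k = 1` over `ℝ`** (Lemma 5.1.5 for `S = {r²}`; cf. the
characteristic-`0` treatment in `SphericalHarmonics`): `𝒫ᵏ = (𝒫ᵏ ∩ ker Δ) ⊕ (𝒫ᵏ ∩ r²𝒫)` and
`𝒫 = ℝ[r²] · ℋ`. [cite: GoodmanWallachGTM255, Lemma 5.1.5 / Corollary 5.6.12] -/
theorem homogeneousSubmodule_eq_ker_laplacian_sup_span
    (Δ : MvPolynomial σ ℝ →ₗ[ℝ] MvPolynomial σ ℝ) (hΔ : ∀ f, Δ f = ∑ i, pderiv i (pderiv i f))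
    (r2 : MvPolynomial σ ℝ) (hr2 : r2 = ∑ i, X i ^ 2) (k : ℕ) :
    homogeneousSubmodule σ ℝ k =
      (homogeneousSubmodule σ ℝ k ⊓ LinearMap.ker Δ) ⊔
        (homogeneousSubmodule σ ℝ k ⊓ (Ideal.span {r2}).restrictScalars ℝ) := by
  obtain ⟨D, hD⟩ := exists_algHom_pderiv (ι := σ)
  have hH : (⨅ g ∈ ({r2} : Set (MvPolynomial σ ℝ)), LinearMap.ker (D g)) = LinearMap.ker Δ := by
    ext f
    simp only [Submodule.mem_iInf, LinearMap.mem_ker, Set.mem_singleton_iff, forall_eq,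
      D_rsq D hD Δ hΔ r2 hr2]
  rw [← hH]
  refine homogeneousSubmodule_eq_harmonic_sup_span D hD (fun g hg => ?_) k
  rw [Set.mem_singleton_iff] at hg
  subst hg
  refine ⟨2, ?_⟩
  rw [hr2]
  exact IsHomogeneous.sum _ _ _ fun i _ => by simpa using (isHomogeneous_X ℝ i).pow 2

/-- `𝒫 = ℝ[r²] · ker Δ` (Corollary 5.6.12, surjectivity of `ℂ[r²] ⊗ ℋ → 𝒫`, here over `ℝ` via
Theorem 5.1.4's argument). [cite: GoodmanWallachGTM255, Corollary 5.6.12 / Theorem 5.1.4 (proof, first half)] -/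
theorem adjoin_rsq_mul_ker_laplacian_eq_top
    (Δ : MvPolynomial σ ℝ →ₗ[ℝ] MvPolynomial σ ℝ) (hΔ : ∀ f, Δ f = ∑ i, pderiv i (pderiv i f))
    (r2 : MvPolynomial σ ℝ) (hr2 : r2 = ∑ i, X i ^ 2) :
    Subalgebra.toSubmodule (Algebra.adjoin ℝ {r2}) * LinearMap.ker Δ = ⊤ := by
  obtain ⟨D, hD⟩ := exists_algHom_pderiv (ι := σ)
  have hH : (⨅ g ∈ ({r2} : Set (MvPolynomial σ ℝ)), LinearMap.ker (D g)) = LinearMap.ker Δ := by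
    ext f
    simp only [Submodule.mem_iInf, LinearMap.mem_ker, Set.mem_singleton_iff, forall_eq,
      D_rsq D hD Δ hΔ r2 hr2]
  rw [← hH]
  refine adjoin_mul_harmonic_eq_top D hD fun g hg => ?_
  rw [Set.mem_singleton_iff] at hg
  subst hg
  refine ⟨2, two_pos, ?_⟩
  rw [hr2]
  exact IsHomogeneous.sum _ _ _ fun i _ => by simpa using (isHomogeneous_X ℝ i).pow 2

end Spherical

/-! ## § 5. Kashiwara–Vergne pluriharmonics: `S = {(xᵗy)_{ij}}`, `𝔥 = ⋂ ker Δ_ij`, `ℂ[X] = ℂ[xᵗy]·𝔥` -/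

section KashiwaraVergne

variable {ιx : Type v} {ιy : Type v} {κ : Type w} [Fintype ιx] [Fintype ιy] [Fintype κ]
  [DecidableEq ιx] [DecidableEq ιy] [DecidableEq κ]

omit [Fintype ιx] [Fintype ιy] [DecidableEq ιx] [DecidableEq ιy] [DecidableEq κ] in
/-- `∂((xᵗy)_{ij}) = Δ_ij = ∑_ν ∂²/∂x_{iν}∂y_{jν}`. [folklore] -/
private theorem D_xty
    (D : MvPolynomial ((ιx ⊕ ιy) × κ) ℝ →ₐ[ℝ] Module.End ℝ (MvPolynomial ((ιx ⊕ ιy) × κ) ℝ))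
    (hD : ∀ z, D (X z) =
      ((pderiv z : Derivation ℝ (MvPolynomial ((ιx ⊕ ιy) × κ) ℝ)
        (MvPolynomial ((ιx ⊕ ιy) × κ) ℝ)) : Module.End ℝ (MvPolynomial ((ιx ⊕ ιy) × κ) ℝ)))
    (Δ : ιx → ιy → MvPolynomial ((ιx ⊕ ιy) × κ) ℝ →ₗ[ℝ] MvPolynomial ((ιx ⊕ ιy) × κ) ℝ)
    (hΔ : ∀ i j f, Δ i j f = ∑ ν : κ, pderiv (Sum.inl i, ν) (pderiv (Sum.inr j, ν) f))
    (T : ιx → ιy → MvPolynomial ((ιx ⊕ ιy) × κ) ℝ)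
    (hT : ∀ i j, T i j = ∑ ν : κ, X (Sum.inl i, ν) * X (Sum.inr j, ν)) (i : ιx) (j : ιy) :
    D (T i j) = Δ i j := by
  refine LinearMap.ext fun f => ?_
  rw [hT, map_sum, hΔ, LinearMap.coe_sum, Finset.sum_apply]
  refine Finset.sum_congr rfl fun ν _ => ?_
  rw [map_mul, Module.End.mul_apply, hD, hD]
  rfl

omit [Fintype ιx] [Fintype ιy] [DecidableEq ιx] [DecidableEq ιy] [DecidableEq κ] in
/-- The pluriharmonics `⋂_{ij} ker Δ_ij` are the `S`-harmonics for `S = {(xᵗy)_{ij}}`. [folklore] -/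
private theorem harmonic_eq_KV
    (D : MvPolynomial ((ιx ⊕ ιy) × κ) ℝ →ₐ[ℝ] Module.End ℝ (MvPolynomial ((ιx ⊕ ιy) × κ) ℝ))
    (hD : ∀ z, D (X z) =
      ((pderiv z : Derivation ℝ (MvPolynomial ((ιx ⊕ ιy) × κ) ℝ)
        (MvPolynomial ((ιx ⊕ ιy) × κ) ℝ)) : Module.End ℝ (MvPolynomial ((ιx ⊕ ιy) × κ) ℝ)))
    (Δ : ιx → ιy → MvPolynomial ((ιx ⊕ ιy) × κ) ℝ →ₗ[ℝ] MvPolynomial ((ιx ⊕ ιy) × κ) ℝ)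
    (hΔ : ∀ i j f, Δ i j f = ∑ ν : κ, pderiv (Sum.inl i, ν) (pderiv (Sum.inr j, ν) f))
    (T : ιx → ιy → MvPolynomial ((ιx ⊕ ιy) × κ) ℝ)
    (hT : ∀ i j, T i j = ∑ ν : κ, X (Sum.inl i, ν) * X (Sum.inr j, ν)) :
    (⨅ g ∈ Set.range (fun p : ιx × ιy => T p.1 p.2), LinearMap.ker (D g)) =
      ⨅ p : ιx × ιy, LinearMap.ker (Δ p.1 p.2) := by
  ext f
  simp only [Submodule.mem_iInf, LinearMap.mem_ker, Set.mem_range]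
  constructor
  · intro h p
    rw [← D_xty D hD Δ hΔ T hT]
    exact h _ ⟨p, rfl⟩
  · rintro h _ ⟨p, rfl⟩
    rw [D_xty D hD Δ hΔ T hT]
    exact h p

omit [Fintype ιx] [Fintype ιy] [DecidableEq ιx] [DecidableEq ιy] [DecidableEq κ] in
/-- The quadrics `(xᵗy)_{ij}` are homogeneous of degree `2`. [folklore] -/
private theorem T_isHomogeneous (T : ιx → ιy → MvPolynomial ((ιx ⊕ ιy) × κ) ℝ)
    (hT : ∀ i j, T i j = ∑ ν : κ, X (Sum.inl i, ν) * X (Sum.inr j, ν)) (i : ιx) (j : ιy) :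
    (T i j).IsHomogeneous 2 := by
  rw [hT]
  exact IsHomogeneous.sum _ _ _ fun ν _ => (isHomogeneous_X ℝ _).mul (isHomogeneous_X ℝ _)

/-- **The pluriharmonic splitting** for the system (5.1) of Kashiwara–Vergne,
`Δ_ij = ∑_{ν=1}^k ∂²/∂x_{iν}∂y_{jν}` on `𝒫(M(p,k) × M(q,k))` (variables `x_{iν} = X (inl i, ν)`,
`y_{jν} = X (inr j, ν)`): `𝒫ᵐ = (𝒫ᵐ ∩ 𝔥) ⊕ (𝒫ᵐ ∩ 𝒫·{(xᵗy)_{ij}})` with `𝔥 = ⋂ ker Δ_ij` the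
pluriharmonic polynomials, over `ℝ` (Lemma 5.1.5 of Goodman–Wallach for `S = {(xᵗy)_{ij}}`,
`∂((xᵗy)_{ij}) = Δ_ij`).
[cite: KashiwaraVergne1978, III (5.1)–(5.2) p. 41–42; GoodmanWallachGTM255, Lemma 5.1.5] -/
theorem homogeneousSubmodule_eq_pluriharmonic_sup_span
    (Δ : ιx → ιy → MvPolynomial ((ιx ⊕ ιy) × κ) ℝ →ₗ[ℝ] MvPolynomial ((ιx ⊕ ιy) × κ) ℝ)
    (hΔ : ∀ i j f, Δ i j f = ∑ ν : κ, pderiv (Sum.inl i, ν) (pderiv (Sum.inr j, ν) f))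
    (T : ιx → ιy → MvPolynomial ((ιx ⊕ ιy) × κ) ℝ)
    (hT : ∀ i j, T i j = ∑ ν : κ, X (Sum.inl i, ν) * X (Sum.inr j, ν)) (m : ℕ) :
    homogeneousSubmodule ((ιx ⊕ ιy) × κ) ℝ m =
      (homogeneousSubmodule ((ιx ⊕ ιy) × κ) ℝ m ⊓ ⨅ p : ιx × ιy, LinearMap.ker (Δ p.1 p.2)) ⊔
        (homogeneousSubmodule ((ιx ⊕ ιy) × κ) ℝ m ⊓
          (Ideal.span (Set.range fun p : ιx × ιy => T p.1 p.2)).restrictScalars ℝ) := by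
  obtain ⟨D, hD⟩ := exists_algHom_pderiv (ι := (ιx ⊕ ιy) × κ)
  rw [← harmonic_eq_KV D hD Δ hΔ T hT]
  refine homogeneousSubmodule_eq_harmonic_sup_span D hD (fun g hg => ?_) m
  obtain ⟨p, rfl⟩ := hg
  exact ⟨2, T_isHomogeneous T hT p.1 p.2⟩

/-- … and the sum is direct. [cite: KashiwaraVergne1978, III (5.1)–(5.2) p. 41–42; GoodmanWallachGTM255, Lemma 5.1.5] -/
theorem disjoint_pluriharmonic_span
    (Δ : ιx → ιy → MvPolynomial ((ιx ⊕ ιy) × κ) ℝ →ₗ[ℝ] MvPolynomial ((ιx ⊕ ιy) × κ) ℝ)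
    (hΔ : ∀ i j f, Δ i j f = ∑ ν : κ, pderiv (Sum.inl i, ν) (pderiv (Sum.inr j, ν) f))
    (T : ιx → ιy → MvPolynomial ((ιx ⊕ ιy) × κ) ℝ)
    (hT : ∀ i j, T i j = ∑ ν : κ, X (Sum.inl i, ν) * X (Sum.inr j, ν)) :
    Disjoint (⨅ p : ιx × ιy, LinearMap.ker (Δ p.1 p.2))
      ((Ideal.span (Set.range fun p : ιx × ιy => T p.1 p.2)).restrictScalars ℝ) := by
  obtain ⟨D, hD⟩ := exists_algHom_pderiv (ι := (ιx ⊕ ιy) × κ)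
  rw [← harmonic_eq_KV D hD Δ hΔ T hT]
  exact disjoint_harmonic_span D hD _

/-- **Kashiwara–Vergne, Ch. III Lemma (5.3): `ℂ[X] = ℂ[xᵗy] 𝔥`** — every polynomial on
`X = M(p,k) × M(q,k)` is a sum of products of a polynomial in the `(xᵗy)_{ij} = ∑_ν x_{iν} y_{jν}`
with a pluriharmonic polynomial; here over `ℝ`, for every `k = |κ|`, as
`Subalgebra.toSubmodule (Algebra.adjoin ℝ {(xᵗy)_{ij}}) * ⋂ ker Δ_ij = ⊤` (the argument of
Goodman–Wallach Theorem 5.1.4). The tree's `KashiwaraVergne1978.KVPoly.xty_mul_harmonics_eq_top` is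
the case `k = 1` over any field.
[cite: KashiwaraVergne1978, III Lemma (5.3) p. 42; GoodmanWallachGTM255, Theorem 5.1.4 (proof, first half)] -/
theorem adjoin_xty_mul_pluriharmonic_eq_top
    (Δ : ιx → ιy → MvPolynomial ((ιx ⊕ ιy) × κ) ℝ →ₗ[ℝ] MvPolynomial ((ιx ⊕ ιy) × κ) ℝ)
    (hΔ : ∀ i j f, Δ i j f = ∑ ν : κ, pderiv (Sum.inl i, ν) (pderiv (Sum.inr j, ν) f))
    (T : ιx → ιy → MvPolynomial ((ιx ⊕ ιy) × κ) ℝ)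
    (hT : ∀ i j, T i j = ∑ ν : κ, X (Sum.inl i, ν) * X (Sum.inr j, ν)) :
    Subalgebra.toSubmodule (Algebra.adjoin ℝ (Set.range fun p : ιx × ιy => T p.1 p.2)) *
        (⨅ p : ιx × ιy, LinearMap.ker (Δ p.1 p.2)) = ⊤ := by
  obtain ⟨D, hD⟩ := exists_algHom_pderiv (ι := (ιx ⊕ ιy) × κ)
  rw [← harmonic_eq_KV D hD Δ hΔ T hT]
  refine adjoin_mul_harmonic_eq_top D hD fun g hg => ?_
  obtain ⟨p, rfl⟩ := hg
  exact ⟨2, two_pos, T_isHomogeneous T hT p.1 p.2⟩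

end KashiwaraVergne

end

end Literature.RepresentationTheory.ClassicalInvariants.HarmonicGeneration
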